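/-
Copyright (c) 2026. All rights reserved.
Released under Apache 2.0 license as described in the file LICENSE.
Authors: abc-iut cell, statement-typer seat abc-iut-L4-t3 (wave 1).
-/
import Mathlib.Algebra.Category.Grp.Basic
import Literature.AnabelianGeometry.AbsoluteAnabelian.TPairs
import Literature.AnabelianGeometry.EtaleTheta.KummerMapFunctoriality
import HarnessLib

/-!
# [AbsTopIII] Corollary 5.2 (iii), main clause: the functorial Kummer map of a global `T`-pair

S. Mochizuki, *Topics in absolute anabelian geometry III: global reconstruction algorithms*,
J. Math. Sci. Univ. Tokyo 22 (2015) 939–1156 [MochizukiAbsTopIII2015]; locators `p.N` = pages of the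
author's manuscript (`paper:url-5493eb38cbb7`), read on the page: Cor 5.2 (iii) p. 119 ("In the notation of (ii),
there exists a functorial [i.e., relative to `Th⊚_T`] algorithm for constructing the Kummer map
`M⊚_TM ⥲ (M⊚_TM)^gp ⥲ M⊚_TLG ↪ lim_{→J} H¹(J, μ_Ẑ(M⊚_TM)) ⥲ lim_{→J} H¹(J, μ_Ẑ(Π))` — where “`J`” ranges over the
open subgroups of `Π`"), Def 5.1 (v) pp. 116–117 ("`M_{T⊚}(Π)` for the object of `T⊚`, equipped with a continuous
action by `Π`, determined by `k_NF(Π)` [if `T⊚ = TF`], `k^×_NF(Π)` [if `T⊚ = TLG`], equipped with the discrete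
topology"), Def 5.1 (ii) p. 114 (`k_NF(Π_X)` = the field "`k̄^×_NF ∪ {0} (≅ k̄_NF)`" constructed in Thm 1.9 (e)).

`TPairs.lean` (seat abc-iut-L4-t3) typed Cor 5.2 (iii) only PARTIALLY: its two "in particular" uniqueness clauses
(`ReferencePairIsoUnique`, `TPairHomDeterminedByTheaterHom`); the MAIN clause — the Kummer map — needs the underlying
abelian groups of the objects of `T⊚` and the direct limit of the `H¹`, absent from the interface `TPairVocabulary`.
This file types it, at universe `0` (Mathlib's `groupCohomology` is single-universe), as follows.
* INTERFACE `TPairVocabulary.GlobCarrier W`: the underlying (discrete) abelian group `|M|` of an object `M` of `T⊚`,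
  functorial in `T⊚` (objects of `T⊚ ∈ {TF, TLG}` ARE topological fields / topological abelian groups, Def 3.1 (i),
  abc-iut-L4-t2 — TODO-merge; the slot is the forgetful functor), with the two printed properties of the global
  arithmetic data `M⊚ ≅ M_{T⊚}(Π) ≅ k̄^×_NF(Π)` that make the Kummer map meaningful: `|M⊚|` is divisible
  (`rootable`: `k̄_NF` is algebraically closed) and the `Π`-action on the DISCRETE group `|M⊚|` is continuous, i.e. has
  open stabilisers (`exists_open_stabilizer`).
* Over it the Kummer map is DEFINED, not postulated: `GlobCarrier.globalKummerMap C P : |M⊚| → lim_{→J} H¹(J, Λ(|M⊚|))`,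
  `J` over the open subgroups of `Π` (index poset `OpenIdx`, reverse inclusion), is abc-iut-L2-t3's real Kummer map
  `EtaleTheta.kummerMap` (LANA §6.1; Mathlib `groupCohomology.H1` of the Tate module `Λ(|M⊚|) = lim |M⊚|[n]`, which is
  print's `μ_Ẑ(M⊚_TM) := Hom(ℚ/ℤ, M⊚_TM)`), for the `Π`-action `GlobCarrier.action` induced by `P.act : Π → Aut(M⊚)`.
* "functorial [i.e., relative to `Th⊚_T`]" is then a THEOREM (`globalKummerMap_natural`): for a morphism of global
  `T`-pairs `φ : M⊚₁ → M⊚₂` (open injection `Π₁ ↪ Π₂`, equivariant `φ⊚ : M⊚₁ ≅ M⊚₂`) the Kummer maps intertwine the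
  map of direct limits induced by the co-morphism `(Π₁ ↪ Π₂, |φ⊚|⁻¹)` (abc-iut-L2-t3's `CoMorphism.colimMap`,
  `colimMap_kummerMap`), the `J`-systems being matched by pull-back of open subgroups.
* "`↪`" is the named `Prop` fact `Cor52iiiKummerInjective` (an assumption on `(W, C)`, true for the genuine data:
  Kummer theory of the number fields `k̄_NF^J`).
NOT typed here (TODO(general form)): the first two arrows `M⊚_TM ⥲ (M⊚_TM)^gp ⥲ M⊚_TLG` (for GLOBAL arithmetic data the
`TM`- and `TLG`-versions have the same underlying group, a group being its own groupification — abc-iut-L2-t3's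
`monoidKummerMap` is the monoid form), and the last arrow `lim H¹(J, μ_Ẑ(M⊚_TM)) ⥲ lim H¹(J, μ_Ẑ(Π))`, the transport of
coefficients along the unique isomorphism of Cor 5.2 (ii) (`CyclotomeIsoUnique`), which needs `μ_Ẑ(Π)` of Thm 1.9 (b)
as a `Π`-MODULE (the vocabulary's `cyclotomeGrp` carries no action; abc-iut-L4-t1). Discrete `H¹` of the abstract
open subgroup `J` is used, as in abc-iut-L2-t3's files (for open `J` acting continuously on a discrete module this is
the continuous `H¹`). Refereed pre-IUT material; nothing here bears on [IUTchIII] Cor. 3.12; typed ≠ discharged.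
-/

noncomputable section

open CategoryTheory

namespace Literature.AnabelianGeometry.AbsoluteAnabelian

open Literature.AnabelianGeometry.EtaleTheta

variable {R : GlobalAnabelianContext.{0}} {T : TKind} (W : TPairVocabulary R T)

/-- INTERFACE (TODO-merge abc-iut-L4-t2, Def 3.1 (i): the objects of `T⊚ ∈ {TF, TLG}` are ind-topological fields /
abelian groups): the underlying discrete abelian group `|M|` of an object `M` of `T⊚`, functorially in `T⊚`, together
with the printed properties of the global arithmetic data `M⊚` of a global `T`-pair ("`M_{T⊚}(Π)` … determined by
`k_NF(Π)` [if `T⊚ = TF`], `k^×_NF(Π)` [if `T⊚ = TLG`], equipped with the discrete topology", "equipped with a continuous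
action by `Π`", `k_NF(Π) ≅ k̄_NF` an algebraic closure of `ℚ`): `|M⊚|` is divisible and the stabilisers of the
`Π`-action on `|M⊚|` are open. [cite: MochizukiAbsTopIII2015, Def 5.1 (v) pp. 116–117] -/
structure TPairVocabulary.GlobCarrier : Type 2 where
  /-- the underlying abelian group `|M|` of `M ∈ Ob(T⊚)` (multiplicatively written: `k̄^×_NF`), bundled as an object
  of Mathlib's category of commutative groups `CommGrpCat` (so that no instance is declared in this file) -/
  carrier : W.GlobObj → CommGrpCat.{0}
  /-- functoriality: a morphism of `T⊚` induces a homomorphism of underlying groups -/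
  map : ∀ {M N : W.GlobObj}, (M ⟶ N) → (carrier M →* carrier N)
  /-- identities go to identities -/
  map_id : ∀ M : W.GlobObj, map (𝟙 M) = MonoidHom.id (carrier M)
  /-- composites go to composites -/
  map_comp : ∀ {M N O : W.GlobObj} (f : M ⟶ N) (g : N ⟶ O), map (f ≫ g) = (map g).comp (map f)
  /-- `|M⊚|` is divisible (`k̄_NF` is algebraically closed): every element has `n`-th roots for all `n ≥ 1` -/
  rootable : ∀ P : GlobalTPair W, RootableBy (carrier P.M) ℕ
  /-- the action `Π ↷ |M⊚|` is continuous for the discrete topology: stabilisers are open -/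
  exists_open_stabilizer : ∀ (P : GlobalTPair W) (m : carrier P.M),
    ∃ U : OpenSubgroup P.theater.grp, ∀ u : P.theater.grp, u ∈ U → map (P.act u).hom m = m

namespace TPairVocabulary.GlobCarrier

variable {W} (C : W.GlobCarrier)

/-- an automorphism of `M` in `T⊚` acts on `|M|` by a group automorphism. [cite: MochizukiAbsTopIII2015, Def 5.1 (v) p. 117] -/
def autToMulAut (M : W.GlobObj) : Aut M →* MulAut (C.carrier M) where
  toFun e := MonoidHom.toMulEquiv (C.map e.hom) (C.map e.inv)
    (by rw [← C.map_comp, e.hom_inv_id, C.map_id]) (by rw [← C.map_comp, e.inv_hom_id, C.map_id])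
  map_one' := by
    ext m
    change C.map (𝟙 M) m = m
    rw [C.map_id]; rfl
  map_mul' e f := by
    ext m
    change C.map (f.hom ≫ e.hom) m = C.map e.hom (C.map f.hom m)
    rw [C.map_comp]; rfl

/-- the value of `autToMulAut`. [cite: MochizukiAbsTopIII2015, Def 5.1 (v) p. 117] -/
@[simp] theorem autToMulAut_apply (M : W.GlobObj) (e : Aut M) (m : C.carrier M) :
    C.autToMulAut M e m = C.map e.hom m := rfl

variable (P : GlobalTPair W)

/-- the continuous action `Π ↷ M⊚` of a global `T`-pair read on the underlying group `|M⊚|`, as a homomorphism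
`Π → Aut(|M⊚|)`. [cite: MochizukiAbsTopIII2015, Def 5.1 (v) p. 117] -/
def actionHom : P.theater.grp →* MulAut (C.carrier P.M) := (C.autToMulAut P.M).comp P.act

/-- the action `Π ↷ |M⊚|` by group automorphisms (a `MulDistribMulAction`; a definition, not an instance).
[cite: MochizukiAbsTopIII2015, Def 5.1 (v) p. 117] -/
@[reducible] def action : MulDistribMulAction P.theater.grp (C.carrier P.M) :=
  MulDistribMulAction.compHom (C.carrier P.M) (C.actionHom P)

/-- unfolding the action: `g • m = |P.act g| (m)`. [cite: MochizukiAbsTopIII2015, Def 5.1 (v) p. 117] -/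
theorem action_smul (g : P.theater.grp) (m : C.carrier P.M) :
    (letI := C.action P; g • m) = C.map (P.act g).hom m := rfl

/-! ## The system of open subgroups `J ⊆ Π` -/

/-- the index poset of "`J` ranges over the open subgroups of `Π`", ordered by REVERSE inclusion (so that the `H¹`
form an inductive system along `≤`). [cite: MochizukiAbsTopIII2015, Cor 5.2 (iii) p. 119] -/
abbrev OpenIdx : Type := (OpenSubgroup P.theater.grp)ᵒᵈ

/-- the system `J ↦ J` of subgroups of `Π` indexed by `OpenIdx`. [cite: MochizukiAbsTopIII2015, Cor 5.2 (iii) p. 119] -/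
def openSystem (i : OpenIdx P) : Subgroup P.theater.grp := ((OrderDual.ofDual i : OpenSubgroup P.theater.grp) : Subgroup _)

/-- the system is antitone for reverse inclusion. [cite: MochizukiAbsTopIII2015, Cor 5.2 (iii) p. 119] -/
theorem openSystem_anti : ∀ ⦃i j : OpenIdx P⦄, i ≤ j → openSystem P j ≤ openSystem P i :=
  fun _ _ h => OpenSubgroup.toSubgroup_le.mpr (OrderDual.ofDual_le_ofDual.mpr h)

/-- hypothesis (c) of the Kummer-map construction — `|M⊚| = ⋃_J |M⊚|^J` — holds: stabilisers are open.
[cite: MochizukiAbsTopIII2015, Def 5.1 (v) p. 117] -/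
theorem isExhausted : letI := C.action P; IsExhausted (C.carrier P.M) (openSystem P) := by
  letI := C.action P
  intro m
  obtain ⟨U, hU⟩ := C.exists_open_stabilizer P m
  refine ⟨OrderDual.toDual U, ?_⟩
  rintro ⟨u, hu⟩
  exact hU u hu

/-! ## The Kummer map `|M⊚| → lim_{→J} H¹(J, Λ(|M⊚|))` -/

open scoped Classical in
/-- the target `lim_{→J} H¹(J, μ_Ẑ(M⊚_TM))`: the direct limit over the open subgroups `J ⊆ Π` of the cohomology
`H¹(J, Λ(|M⊚|))` of the Tate module `Λ(|M⊚|) = Hom(ℚ/ℤ, |M⊚|)` (abc-iut-L2-t3's `H1Colimit`).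
[cite: MochizukiAbsTopIII2015, Cor 5.2 (iii) p. 119] -/
def kummerTarget : Type := letI := C.action P; H1Colimit (C.carrier P.M) (openSystem P) (openSystem_anti P)

open scoped Classical in
/-- its additive group structure (a definition, not an instance). [cite: MochizukiAbsTopIII2015, Cor 5.2 (iii) p. 119] -/
@[reducible] def kummerTargetAddCommGroup : AddCommGroup (C.kummerTarget P) := by
  letI := C.action P
  unfold kummerTarget
  infer_instance

open scoped Classical in
/-- **Cor 5.2 (iii), main clause — the Kummer map** `M⊚_TLG → lim_{→J} H¹(J, μ_Ẑ(M⊚_TM))` of a global `T`-pair,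
CONSTRUCTED (abc-iut-L2-t3's `kummerMap`: `κ(m)` = the image of the level-`J` Kummer class of `m` for any open `J`
fixing `m`, computed from a compatible system of roots of `m`). [cite: MochizukiAbsTopIII2015, Cor 5.2 (iii) p. 119] -/
def globalKummerMap : C.carrier P.M → C.kummerTarget P :=
  letI := C.action P
  letI := C.rootable P
  kummerMap (openSystem_anti P) (C.isExhausted P)

/-! ## Functoriality relative to `Th⊚_T` -/

variable {P} {P₁ P₂ : GlobalTPair W}

/-- a morphism of global `T`-pairs `φ : M⊚₁ → M⊚₂` as an equivariant CO-MORPHISM `(Π₁ → Π₂, |φ⊚|⁻¹ : |M⊚₂| → |M⊚₁|)`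
(equivariance from Def 5.1 (v) (a): `φ⊚` is equivariant along `Π₁ ↪ Π₂`).
[cite: MochizukiAbsTopIII2015, Def 5.1 (v) p. 117] -/
def coMorphism (φ : GlobalTPair.Hom W P₁ P₂) :
    letI := C.action P₁; letI := C.action P₂
    CoMorphism P₂.theater.grp (C.carrier P₂.M) P₁.theater.grp (C.carrier P₁.M) := by
  letI := C.action P₁; letI := C.action P₂
  refine ⟨(φ.φV.φgrp.arith : P₁.theater.grp →* P₂.theater.grp), C.map φ.φM.inv, fun γ m => ?_⟩
  change C.map φ.φM.inv (C.map (P₂.act (φ.φV.φgrp.arith γ)).hom m) = C.map (P₁.act γ).hom (C.map φ.φM.inv m)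
  have h := φ.φM_equivariant γ
  have h' : (P₂.act (φ.φV.φgrp.arith γ)).hom ≫ φ.φM.inv = φ.φM.inv ≫ (P₁.act γ).hom := by
    rw [← cancel_epi φ.φM.hom, ← Category.assoc, ← h, Category.assoc, Iso.hom_inv_id, Category.comp_id,
      Iso.hom_inv_id_assoc]
  rw [← MonoidHom.comp_apply, ← C.map_comp, h', C.map_comp, MonoidHom.comp_apply]

/-- pull-back of open subgroups along `Π₁ → Π₂` matches the two `J`-systems: `J ↦ φ⁻¹(J)`.
[cite: MochizukiAbsTopIII2015, Cor 5.2 (iii) p. 119] -/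
def pullIdx (φ : GlobalTPair.Hom W P₁ P₂) (i : OpenIdx P₂) : OpenIdx P₁ :=
  OrderDual.toDual ((OrderDual.ofDual i).comap (φ.φV.φgrp.arith : P₁.theater.grp →* P₂.theater.grp)
    φ.φV.φgrp.arith.continuous_toFun)

/-- `φ(φ⁻¹(J)) ⊆ J`. [cite: MochizukiAbsTopIII2015, Cor 5.2 (iii) p. 119] -/
theorem map_pullIdx_le (φ : GlobalTPair.Hom W P₁ P₂) (i : OpenIdx P₂) :
    letI := C.action P₁; letI := C.action P₂
    (openSystem P₁ (pullIdx φ i)).map (C.coMorphism φ).groupHom ≤ openSystem P₂ i := by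
  letI := C.action P₁; letI := C.action P₂
  exact Subgroup.map_comap_le _ _

open scoped Classical in
/-- the map of direct limits `lim_J H¹(J, Λ|M⊚₂|) → lim_{J'} H¹(J', Λ|M⊚₁|)` induced by a morphism of global
`T`-pairs (abc-iut-L2-t3's `CoMorphism.colimMap`). [cite: MochizukiAbsTopIII2015, Cor 5.2 (iii) p. 119] -/
def kummerTargetMap (φ : GlobalTPair.Hom W P₁ P₂) : C.kummerTarget P₂ → C.kummerTarget P₁ :=
  letI := C.action P₁; letI := C.action P₂
  (C.coMorphism φ).colimMap (openSystem P₂) (openSystem_anti P₂) (openSystem P₁) (openSystem_anti P₁)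
    (pullIdx φ) (C.map_pullIdx_le φ)

open scoped Classical in
/-- **Cor 5.2 (iii), "functorial [i.e., relative to `Th⊚_T`]" — PROVED for the constructed Kummer map**: for a
morphism of global `T`-pairs `φ : M⊚₁ → M⊚₂` and `m ∈ |M⊚₂|`, the induced map of direct limits sends `κ₂(m)` to
`κ₁(|φ⊚|⁻¹ m)`. [cite: MochizukiAbsTopIII2015, Cor 5.2 (iii) p. 119] -/
theorem globalKummerMap_natural (φ : GlobalTPair.Hom W P₁ P₂) (m : C.carrier P₂.M) :
    C.kummerTargetMap φ (C.globalKummerMap P₂ m) = C.globalKummerMap P₁ (C.map φ.φM.inv m) := by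
  letI := C.action P₁; letI := C.action P₂
  letI := C.rootable P₁; letI := C.rootable P₂
  exact (C.coMorphism φ).colimMap_kummerMap (openSystem P₂) (openSystem_anti P₂) (openSystem P₁)
    (openSystem_anti P₁) (pullIdx φ) (C.map_pullIdx_le φ) (C.isExhausted P₂) (C.isExhausted P₁) m

end TPairVocabulary.GlobCarrier

/-- **Cor 5.2 (iii), main clause — the `↪`** (named fact; `T ∈ {TF, TM}`; an assumption on `(W, C)` which the text
asserts for the genuine global `T`-pairs): the Kummer map `M⊚_TLG → lim_{→J} H¹(J, μ_Ẑ(M⊚_TM))` is injective.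
[cite: MochizukiAbsTopIII2015, Cor 5.2 (iii) p. 119] -/
def Cor52iiiKummerInjective (_hT : T ≠ .TLG) (C : W.GlobCarrier) : Prop :=
  ∀ P : GlobalTPair W, Function.Injective (C.globalKummerMap P)

end Literature.AnabelianGeometry.AbsoluteAnabelian

end
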